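import Literature.AlgebraicGeometry.Frobenioids.ArchimedeanPerfectionRadialTransport
import Literature.AlgebraicGeometry.Frobenioids.ArchimedeanPerfectionBiratUnitsLink
import HarnessLib

/-!
# Frobenioids II, Thm. 3.6 (i) at `Λ = ℚ`, piece P2 (v): transport of ARBITRARY scalar germs — in particular of
# the unit (rotation) germs — along linear arrows of `C^pf` (the archimedean core of `(T-unit)`)

Mochizuki, *The geometry of Frobenioids II: poly-Frobenioids*, Kyushu J. Math. **62** (2008) 401–460, §3,
Thm. 3.6 (i)/(v) p. 36–37 [cite: MochizukiFrdII2008, Thm 3.6 (i) p.36]; [FrdI] Prop. 2.2 (ii)(a) p. 45,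
Prop. 4.4 (iv) p. 83 [cite: MochizukiFrdI2008, Prop. 4.4 (iv) p.83].

abc-iut cell, layer L1, row M13-c3 piece **P2** (seat abc-iut-w5-d246), file 2f of the P2 chain.  For
`ψ = [ψ₀] : (A, n) → (A′, n′)` linear at adapted naively isotropic levels `(a, b)` and scalars `z` of `A^{(a)}`,
`z′` of `A′^{(b)}` with **`z = (Base ψ₀).act z′`** (the Galois twist of the base of `ψ₀`), the germs `germ_X(z)` and
`germ_{X′}(z′)` are intertwined along `ψ` (**`intertwines_germ_of_act`**; the square `ψ₀|_discs ≫ ι′_{z′} = ι_z ≫ ψ₀`);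
for `|z| = 1` and complex objects this is the intertwining of the ROTATION UNITS (**`intertwines_rotUnit`**, via
file `ArchimedeanPerfectionBiratUnitsLink`: `germ = unitsToBirat ∘ rotUnit`), whose values are
`[τ_a z] ⊗ 1/a` and `[τ_b z′] ⊗ 1/b` (`unitVal_rotUnit`) — the transport of units along `ψ` multiplies `unitVal` by
`b/a = n/n′`.  Proof-only; nothing here bears on [IUTchIII] Cor. 3.12.
-/

noncomputable section

namespace Literature.AlgebraicGeometry.Frobenioids

open CategoryTheory Opposite
open scoped Pointwise NNReal

universe v u

namespace ArchFrd

namespace Thm36Sub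

variable {D : Type u} [Category.{v} D] {π : D ⥤ D0}

open PreFrobenioid PreFrobenioid.Perfection

section Cross

variable {B B' : C π} (ψ₀ : B ⟶ B') (hB : B.fst.IsNaivelyIsotropic) (hB' : B'.fst.IsNaivelyIsotropic)

/-- **The transport square in `C` for twisted scalars**: `ψ₀|_discs ≫ ι′_{z′} = ι_z ≫ ψ₀` whenever
`z = (Base ψ₀).act z′` and `ψ₀` is linear. [cite: MochizukiFrdI2008, Prop. 4.4 (iv) p.83] -/
theorem crossDisc_comp_discIncl_of_act (hψ₀ : C0.degFr ψ₀.fst = 1) (t t' : PosReal)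
    (h : ‖(C0.scalar ψ₀.fst : ℂ)‖ * t ≤ t') {z z' : ℂˣ} (ez : z = (C0.Base ψ₀.fst :).act z')
    (hz : z ∈ D0.scalars B.fst.base) (hz' : z' ∈ D0.scalars B'.fst.base) (hr : ‖(z : ℂ)‖ * t ≤ B.fst.tip)
    (hr' : ‖(z' : ℂ)‖ * t' ≤ B'.fst.tip) :
    crossDisc ψ₀ t t' h ≫ discIncl B' hB' t' z' hz' hr' = discIncl B hB t z hz hr ≫ ψ₀ := by
  refine CFP.hom_ext (C0.hom_ext ?_ ?_ ?_) ?_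
  · rw [CFP.comp_fst, CFP.comp_fst, C0.base_comp', C0.base_comp', base_discIncl, base_discIncl, base_crossDisc]
    exact (Category.comp_id _).trans (Category.id_comp _).symm
  · rw [CFP.comp_fst, CFP.comp_fst, C0.degFr_comp', C0.degFr_comp', degFr_discIncl, degFr_discIncl, degFr_crossDisc, hψ₀]
  · rw [CFP.comp_fst, CFP.comp_fst, C0.scalar_comp', C0.scalar_comp', scalar_discIncl, scalar_discIncl,
      degFr_discIncl, base_discIncl, base_crossDisc, scalar_crossDisc, hψ₀, PNat.one_coe, pow_one, pow_one, ez,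
      D0.Hom.act, D0.Hom.act, D0.twists_id, D0.galAct_false, mul_comm]
  · rw [CFP.comp_snd, CFP.comp_snd, discIncl_snd, discIncl_snd, crossDisc_snd]
    exact (Category.comp_id _).trans (Category.id_comp _).symm

end Cross

section Pf

variable {hF : PreFrobenioid.IsFrobenioid (C.toElem π)} (X X' : pfCat π hF)
  (hPf : PreFrobenioid.IsFrobenioid (pfStr π hF)) {a b : ℕ+} (e : X.idx * a = X'.idx * b)
  (hc : (frobPow hF X.obj a).fst.IsNaivelyIsotropic) (hc' : (frobPow hF X'.obj b).fst.IsNaivelyIsotropic)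

/-- **Transport of scalar germs at adapted levels**: for `ψ = [ψ₀]`, `ψ₀ : A^{(a)} → A′^{(b)}` linear, `n a = n′ b`,
and scalars `z = (Base ψ₀).act z′`, the germs `germ_X(z)` (level `a`) and `germ_{X′}(z′)` (level `b`) satisfy
`ψ ∘ germ = germ′ ∘ ψ` in `C^birat`. [cite: MochizukiFrdI2008, Prop. 4.4 (iv) p.83] -/
theorem intertwines_germ_of_act (ψ₀ : frobPow hF X.obj a ⟶ frobPow hF X'.obj b) (hψ₀ : C0.degFr ψ₀.fst = 1)
    {z z' : ℂˣ} (ez : z = (C0.Base ψ₀.fst :).act z') (hz : z ∈ D0.scalars (frobPow hF X.obj a).fst.base)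
    (hz' : z' ∈ D0.scalars (frobPow hF X'.obj b).fst.base) :
    BiratUnits.Intertwines hPf (Hom.mk (⟨⟨a, b, e⟩, ψ₀⟩ : Rep X X')) (germ X hPf hc z hz) (germ X' hPf hc' z' hz') := by
  have hn : ‖(z : ℂ)‖ = ‖(z' : ℂ)‖ := by rw [ez]; exact D0.norm_galAct _ _
  let t' : PosReal := rad (frobPow hF X'.obj b) z'
  let t₁ : PosReal := rad (frobPow hF X.obj a) z
  let t₂ : PosReal := rad (disc (frobPow hF X'.obj b) t') (C0.scalar ψ₀.fst)
  let t : PosReal := ⟨min (t₁ : ℝ) (t₂ : ℝ), lt_min t₁.2 t₂.2⟩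
  have h1 : (t : ℝ) ≤ t₁ := min_le_left _ _
  have h2 : (t : ℝ) ≤ t₂ := min_le_right _ _
  have ht : (t : ℝ) ≤ (frobPow hF X.obj a).fst.tip := h1.trans (rad_le _ _)
  have hr : ‖(z : ℂ)‖ * t ≤ (frobPow hF X.obj a).fst.tip :=
    (mul_le_mul_of_nonneg_left h1 (norm_nonneg _)).trans (norm_mul_rad_le _ _)
  have h : ‖(C0.scalar ψ₀.fst : ℂ)‖ * t ≤ t' :=
    (mul_le_mul_of_nonneg_left h2 (norm_nonneg _)).trans (norm_mul_rad_le _ _)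
  have ht' : (t' : ℝ) ≤ (frobPow hF X'.obj b).fst.tip := rad_le _ _
  have hr' : ‖(z' : ℂ)‖ * t' ≤ (frobPow hF X'.obj b).fst.tip := norm_mul_rad_le _ _
  have e1 : (1 : ℂˣ) = (C0.Base ψ₀.fst :).act 1 := (map_one _).symm
  rw [germ_eq_mk_stdFrac X hPf hc z hz t ht hr]
  refine ⟨stdFrac X a hc t ht z hz hr, stdFrac X' b hc' t' ht' z' hz' hr', discPf X a t, 𝟙 _,
    crossPf X X' e (crossDisc ψ₀ t t' h), rfl, rfl, isCoAngularPreStep_id hPf _, ?_, ?_⟩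
  · change crossPf X X' e (crossDisc ψ₀ t t' h) ≫ inclHom X' b t' (discIncl _ hc' t' 1 _ _) =
      𝟙 _ ≫ inclHom X a t (discIncl _ hc t 1 _ _) ≫ Hom.mk ⟨⟨a, b, e⟩, ψ₀⟩
    rw [Category.id_comp, crossPf_comp_inclHom, inclHom_comp_mk, Category.assoc,
      crossDisc_comp_discIncl_of_act ψ₀ hc hc' hψ₀ t t' h e1 (one_mem _) (one_mem _) (norm_one_mul_le ht)
        (norm_one_mul_le ht')]
  · change crossPf X X' e (crossDisc ψ₀ t t' h) ≫ inclHom X' b t' (discIncl _ hc' t' z' _ _) =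
      𝟙 _ ≫ inclHom X a t (discIncl _ hc t z _ _) ≫ Hom.mk ⟨⟨a, b, e⟩, ψ₀⟩
    rw [Category.id_comp, crossPf_comp_inclHom, inclHom_comp_mk, Category.assoc,
      crossDisc_comp_discIncl_of_act ψ₀ hc hc' hψ₀ t t' h ez hz hz' hr hr']

/-- **Transport of the rotation units** (complex objects): for `ψ = [ψ₀]` as above and norm-one scalars
`z = (Base ψ₀).act z′`, the units `[rot_z]` of `X` (level `a`) and `[rot_{z′}]` of `X′` (level `b`) are intertwined
along `ψ` in `C^birat`; their values are `[τ_a z] ⊗ 1/a` and `[τ_b z′] ⊗ 1/b` (`unitVal_rotUnit`).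
[cite: MochizukiFrdII2008, Thm 3.6 (v) p.37] -/
theorem intertwines_rotUnit (ψ₀ : frobPow hF X.obj a ⟶ frobPow hF X'.obj b) (hψ₀ : C0.degFr ψ₀.fst = 1)
    (hcx : (frobPow hF X.obj a).fst.IsComplexObj) (hcx' : (frobPow hF X'.obj b).fst.IsComplexObj)
    {z z' : ℂˣ} (ez : z = (C0.Base ψ₀.fst :).act z') (h1 : ‖(z : ℂ)‖ = 1) (h1' : ‖(z' : ℂ)‖ = 1) :
    BiratUnits.Intertwines hPf (Hom.mk (⟨⟨a, b, e⟩, ψ₀⟩ : Rep X X'))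
      (BiratUnits.unitsToBirat hPf X (rotUnit X hc hcx z h1))
      (BiratUnits.unitsToBirat hPf X' (rotUnit X' hc' hcx' z' h1')) := by
  have hz : z ∈ D0.scalars (frobPow hF X.obj a).fst.base := by
    rw [show (frobPow hF X.obj a).fst.base = D0.complex from hcx, D0.scalars_complex]; exact Subgroup.mem_top z
  have hz' : z' ∈ D0.scalars (frobPow hF X'.obj b).fst.base := by
    rw [show (frobPow hF X'.obj b).fst.base = D0.complex from hcx', D0.scalars_complex]; exact Subgroup.mem_top z'
  rw [← germ_eq_unitsToBirat X hPf hc hcx z h1 hz, ← germ_eq_unitsToBirat X' hPf hc' hcx' z' h1' hz']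
  exact intertwines_germ_of_act X X' hPf e hc hc' ψ₀ hψ₀ ez hz hz'

end Pf

end Thm36Sub

end ArchFrd

end Literature.AlgebraicGeometry.Frobenioids

end
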